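import Summits.ResolutionOfSingularities.ResolutionOfSingularities.Theorems.FrobeniusClosingPatchingRelPerfectConeDepthSmoothSurfaceRung
import Summits.ResolutionOfSingularities.ResolutionOfSingularities.Theorems.FrobeniusClosingPatchingRelPerfectConeDepthSmoothConeFermat
import HarnessLib

/-!
# Crux `PatchingRelPerfect` (stmt-ResolutionOfSingularities-16161), chain W5.2 — rung «r-smooth-surface-d-ℓ», instance: the FERMAT
# SURFACE CONES `x₀^d + x₁^d + x₂^d + x₃^d` of every degree `d` invertible in `S`, at every depth

[OURS · L1 W5.2 · rung tool] Replaces the role of NO printed item; NOT a statement of the manuscript under review; fact-free.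
AI-written (AI review is weaker than expert review).

The reduced chart polynomials of `T₀^d + … + T₃^d` are `F_i = 1 + Σ_{j ≠ i} T_j^d`; with the three surviving variables `u, v, w`:
`d·F_i − uF_u − vF_v − wF_w = d`, a unit when `d ∈ S×` — the smoothness certificates of `smoothSurfaceRung_of_ringKrullDim`.
Hence `(x₀^d + x₁^d + x₂^d + x₃^d) + 𝔪^{ℓ+d} ∈ 𝒞` for every `ℓ` and every `d = n + 1` with `d ∈ S×` (`fermatSurfaceRung_of_ringKrullDim`).

## References
* J. Kollár, *Lectures on Resolution of Singularities* (2007), 3.61. [Kollar2007]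
* H. Matsumura, *Commutative Ring Theory*, Thm. 30.3. [Matsumura1987]
-/

set_option linter.dupNamespace false

noncomputable section

open CategoryTheory CategoryTheory.Limits AlgebraicGeometry TopologicalSpace IsLocalRing
open Literature.AlgebraicGeometry.Resolution
open Scheme.IdealSheafData
open scoped Pointwise

namespace Summit.ResolutionOfSingularities.ResolutionOfSingularities.Theorems

universe u

namespace ConeDepth

section FermatSurface

variable {S : Type u} [CommRing S] (n : ℕ)

/-- `T₀^{n+1} + T₁^{n+1} + T₂^{n+1} + T₃^{n+1}` is a form of degree `n + 1`. [folklore] -/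
theorem isHomogeneous_fermatSurface :
    (MvPolynomial.X 0 ^ (n + 1) + MvPolynomial.X 1 ^ (n + 1) + MvPolynomial.X 2 ^ (n + 1) + MvPolynomial.X 3 ^ (n + 1) :
      MvPolynomial (Fin 4) S).IsHomogeneous (n + 1) := by
  have hX : ∀ j : Fin 4, (MvPolynomial.X j ^ (n + 1) : MvPolynomial (Fin 4) S).IsHomogeneous (n + 1) := fun j => by
    simpa using (MvPolynomial.isHomogeneous_X S j).pow (n + 1)
  exact (((hX 0).add (hX 1)).add (hX 2)).add (hX 3)

/-- `Q(x) = x₀^{n+1} + x₁^{n+1} + x₂^{n+1} + x₃^{n+1}`. [folklore] -/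
theorem eval_fermatSurface (x : Fin 4 → S) :
    MvPolynomial.eval x
      (MvPolynomial.X 0 ^ (n + 1) + MvPolynomial.X 1 ^ (n + 1) + MvPolynomial.X 2 ^ (n + 1) + MvPolynomial.X 3 ^ (n + 1) :
        MvPolynomial (Fin 4) S) = x 0 ^ (n + 1) + x 1 ^ (n + 1) + x 2 ^ (n + 1) + x 3 ^ (n + 1) := by
  simp only [map_add, map_pow, MvPolynomial.eval_X]

variable [IsLocalRing S]

/-- The reduced chart polynomials of the Fermat surface form. [folklore] -/
theorem chartPoly_fermatSurface (i : Fin 4) :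
    chartPoly (MvPolynomial.X 0 ^ (n + 1) + MvPolynomial.X 1 ^ (n + 1) + MvPolynomial.X 2 ^ (n + 1) + MvPolynomial.X 3 ^ (n + 1) :
      MvPolynomial (Fin 4) S) i =
      killVar i 0 ^ (n + 1) + killVar i 1 ^ (n + 1) + killVar i 2 ^ (n + 1) + killVar i 3 ^ (n + 1) := by
  simp only [chartPoly, map_add, map_pow, MvPolynomial.map_X, MvPolynomial.aeval_X]

/-- (HC) on a chart `T_i = 1` for the Fermat surface form: with the three surviving variables `u, v, w`,
`(n+1)·F − u ∂_uF − v ∂_vF − w ∂_wF = n+1`. [cite: Matsumura1987, Thm. 30.3] -/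
theorem fermatSurface_HC_of (hd : IsUnit ((n + 1 : ℕ) : S)) (i : Fin 4) (u v w : {j : Fin 4 // j ≠ i}) (huv : u ≠ v)
    (huw : u ≠ w) (hvw : v ≠ w)
    (hF : chartPoly (MvPolynomial.X 0 ^ (n + 1) + MvPolynomial.X 1 ^ (n + 1) + MvPolynomial.X 2 ^ (n + 1) +
      MvPolynomial.X 3 ^ (n + 1) : MvPolynomial (Fin 4) S) i =
      1 + MvPolynomial.X u ^ (n + 1) + MvPolynomial.X v ^ (n + 1) + MvPolynomial.X w ^ (n + 1)) :
    Ideal.span (insert (chartPoly (MvPolynomial.X 0 ^ (n + 1) + MvPolynomial.X 1 ^ (n + 1) + MvPolynomial.X 2 ^ (n + 1) +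
      MvPolynomial.X 3 ^ (n + 1) : MvPolynomial (Fin 4) S) i)
      (Set.range fun t => MvPolynomial.pderiv t (chartPoly (MvPolynomial.X 0 ^ (n + 1) + MvPolynomial.X 1 ^ (n + 1) +
        MvPolynomial.X 2 ^ (n + 1) + MvPolynomial.X 3 ^ (n + 1) : MvPolynomial (Fin 4) S) i))) = ⊤ := by
  classical
  have hd' : ((n + 1 : ℕ) : ResidueField S) ≠ 0 := by
    have h := (hd.map (residue S)).ne_zero; rwa [map_natCast] at h
  rw [hF]
  set F : MvPolynomial {j : Fin 4 // j ≠ i} (ResidueField S) :=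
    1 + MvPolynomial.X u ^ (n + 1) + MvPolynomial.X v ^ (n + 1) + MvPolynomial.X w ^ (n + 1) with hFdef
  set I := Ideal.span (insert F (Set.range fun t => MvPolynomial.pderiv t F)) with hI
  have hFI : F ∈ I := Ideal.subset_span (Set.mem_insert _ _)
  have hdF : ∀ t, MvPolynomial.pderiv t F ∈ I := fun t => Ideal.subset_span (Set.mem_insert_of_mem _ (Set.mem_range_self t))
  have hpu : MvPolynomial.pderiv u F = ((n + 1 : ℕ) : MvPolynomial _ (ResidueField S)) * MvPolynomial.X u ^ n := by
    rw [hFdef, map_add, map_add, map_add, Derivation.map_one_eq_zero, zero_add, pderiv_X_pow_self,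
      pderiv_X_pow_of_ne n (Ne.symm huv), pderiv_X_pow_of_ne n (Ne.symm huw), add_zero, add_zero]
  have hpv : MvPolynomial.pderiv v F = ((n + 1 : ℕ) : MvPolynomial _ (ResidueField S)) * MvPolynomial.X v ^ n := by
    rw [hFdef, map_add, map_add, map_add, Derivation.map_one_eq_zero, zero_add, pderiv_X_pow_of_ne n huv, pderiv_X_pow_self,
      pderiv_X_pow_of_ne n (Ne.symm hvw), zero_add, add_zero]
  have hpw : MvPolynomial.pderiv w F = ((n + 1 : ℕ) : MvPolynomial _ (ResidueField S)) * MvPolynomial.X w ^ n := by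
    rw [hFdef, map_add, map_add, map_add, Derivation.map_one_eq_zero, zero_add, pderiv_X_pow_of_ne n huw,
      pderiv_X_pow_of_ne n hvw, pderiv_X_pow_self, zero_add, zero_add]
  have hmem : MvPolynomial.C ((n + 1 : ℕ) : ResidueField S) * F - MvPolynomial.X u * MvPolynomial.pderiv u F -
      MvPolynomial.X v * MvPolynomial.pderiv v F - MvPolynomial.X w * MvPolynomial.pderiv w F ∈ I :=
    I.sub_mem (I.sub_mem (I.sub_mem (I.mul_mem_left _ hFI) (I.mul_mem_left _ (hdF _))) (I.mul_mem_left _ (hdF _)))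
      (I.mul_mem_left _ (hdF _))
  refine ideal_eq_top_of_mem_of_eq_C hmem ?_ hd'
  rw [hpu, hpv, hpw, hFdef, map_natCast]
  ring

/-- **(HC) for the Fermat surface form on every chart.** [cite: Matsumura1987, Thm. 30.3] -/
theorem fermatSurface_HC (hd : IsUnit ((n + 1 : ℕ) : S)) (i : Fin 4) :
    Ideal.span (insert (chartPoly (MvPolynomial.X 0 ^ (n + 1) + MvPolynomial.X 1 ^ (n + 1) + MvPolynomial.X 2 ^ (n + 1) +
      MvPolynomial.X 3 ^ (n + 1) : MvPolynomial (Fin 4) S) i)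
      (Set.range fun t => MvPolynomial.pderiv t (chartPoly (MvPolynomial.X 0 ^ (n + 1) + MvPolynomial.X 1 ^ (n + 1) +
        MvPolynomial.X 2 ^ (n + 1) + MvPolynomial.X 3 ^ (n + 1) : MvPolynomial (Fin 4) S) i))) = ⊤ := by
  have h0 := fermatSurface_HC_of (S := S) n hd 0 ⟨1, by decide⟩ ⟨2, by decide⟩ ⟨3, by decide⟩ (by decide) (by decide)
    (by decide) (by rw [chartPoly_fermatSurface, killVar_self, killVar_of_ne 0 1 (by decide), killVar_of_ne 0 2 (by decide),
      killVar_of_ne 0 3 (by decide), one_pow])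
  have h1 := fermatSurface_HC_of (S := S) n hd 1 ⟨0, by decide⟩ ⟨2, by decide⟩ ⟨3, by decide⟩ (by decide) (by decide)
    (by decide) (by rw [chartPoly_fermatSurface, killVar_self, killVar_of_ne 1 0 (by decide), killVar_of_ne 1 2 (by decide),
      killVar_of_ne 1 3 (by decide), one_pow]; ring)
  have h2 := fermatSurface_HC_of (S := S) n hd 2 ⟨0, by decide⟩ ⟨1, by decide⟩ ⟨3, by decide⟩ (by decide) (by decide)
    (by decide) (by rw [chartPoly_fermatSurface, killVar_self, killVar_of_ne 2 0 (by decide), killVar_of_ne 2 1 (by decide),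
      killVar_of_ne 2 3 (by decide), one_pow]; ring)
  have h3 := fermatSurface_HC_of (S := S) n hd 3 ⟨0, by decide⟩ ⟨1, by decide⟩ ⟨2, by decide⟩ (by decide) (by decide)
    (by decide) (by rw [chartPoly_fermatSurface, killVar_self, killVar_of_ne 3 0 (by decide), killVar_of_ne 3 1 (by decide),
      killVar_of_ne 3 2 (by decide), one_pow]; ring)
  fin_cases i
  · exact h0
  · exact h1
  · exact h2
  · exact h3

end FermatSurface

/-! ## The rung «r-fermat-surface-ℓ» -/

section FermatSurfaceRung

variable {S : Type u} [CommRing S] [IsRegularLocalRing S]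
  (x : Fin 4 → S) (hx : Ideal.span (Set.range x) = maximalIdeal S) (hdim : ringKrullDim S = (4 : ℕ))
  (n : ℕ) (hd : IsUnit ((n + 1 : ℕ) : S)) (ℓ : ℕ)

include hx hdim hd in
/-- **RUNG «r-fermat-surface-ℓ», UNCONDITIONAL PACKAGE**: for `S` regular local of dimension `4`, `x` spanning `𝔪`, a degree
`d = n + 1` invertible in `S`, `q = x₀^d + x₁^d + x₂^d + x₃^d` and EVERY `ℓ`: (1) `(q) + 𝔪^{ℓ+d} ∈ 𝒞`; (2) the blow-up-form core
conclusion for every `T = Bl_I Spec S`, `I = (q) + 𝔪^{ℓ+d}` (ordinary `d`-fold points of every degree at every depth); fact-free.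
[cite: Kollar2007, 3.61 and (3.111) Step 3] [cite: StacksProject, Tag 080A] -/
theorem fermatSurfaceRung_of_ringKrullDim :
    (∃ (Q : Ideal S) (m : ℕ), IsLocalRing.maximalIdeal S ^ m ≤ Q ∧
      ∃ (B' : Scheme.{u}) (b : B' ⟶ Spec (.of S)),
        IsBlowup b (affineBlowup.idealSheaf
          ((Ideal.span {x 0 ^ (n + 1) + x 1 ^ (n + 1) + x 2 ^ (n + 1) + x 3 ^ (n + 1)} ⊔ maximalIdeal S ^ (ℓ + (n + 1))) * Q)) ∧
        Scheme.IsRegular B') ∧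
    (∀ (T : Scheme.{u}) (f : T ⟶ Spec (.of S)),
      IsBlowup f (affineBlowup.idealSheaf
        (Ideal.span {x 0 ^ (n + 1) + x 1 ^ (n + 1) + x 2 ^ (n + 1) + x 3 ^ (n + 1)} ⊔ maximalIdeal S ^ (ℓ + (n + 1)))) →
      ∃ (J : T.IdealSheafData) (T' : Scheme.{u}) (π : T' ⟶ T), J ≠ ⊥ ∧
        (∀ t : T, t ∈ J.support → f.base t = IsLocalRing.closedPoint S) ∧
        IsBlowup π J ∧ Scheme.IsRegular T') := by
  rw [← eval_fermatSurface n x]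
  exact smoothSurfaceRung_of_ringKrullDim x hx hdim (n + 1) _ (isHomogeneous_fermatSurface n) (fermatSurface_HC n hd) ℓ

end FermatSurfaceRung

/-- **The registered core's binder shape on the member `(x₀^d + x₁^d + x₂^d + x₃^d) + 𝔪^{ℓ+d}`**, `d = n + 1` invertible in `S`
(hypotheses of `stub_atomDimFourBlowup`; completeness, perfectness and the off-fibre hypothesis unused). [cite: Kollar2007, 3.61] -/
theorem atomDimFourBlowupAt_fermatSurface (p : ℕ) (_hp : p.Prime) (S : Type) [CommRing S]
    [IsRegularLocalRing S] [CharP S p] [IsAdicComplete (IsLocalRing.maximalIdeal S) S]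
    [PerfectField (IsLocalRing.ResidueField S)] (hS : ringKrullDim S = (4 : ℕ))
    (x : Fin 4 → S) (hx : Ideal.span (Set.range x) = IsLocalRing.maximalIdeal S)
    (n : ℕ) (hd : IsUnit ((n + 1 : ℕ) : S)) (ℓ : ℕ)
    (T : Scheme.{0}) (f : T ⟶ Spec (.of S))
    (hf : IsBlowup f (affineBlowup.idealSheaf
      (Ideal.span {x 0 ^ (n + 1) + x 1 ^ (n + 1) + x 2 ^ (n + 1) + x 3 ^ (n + 1)} ⊔
        IsLocalRing.maximalIdeal S ^ (ℓ + (n + 1)))))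
    (_hoff : ∀ t : T, f.base t ≠ IsLocalRing.closedPoint S → IsRegularLocalRing (T.presheaf.stalk t)) :
    ∃ (J : T.IdealSheafData) (T' : Scheme.{0}) (π : T' ⟶ T), J ≠ ⊥ ∧
      (∀ t : T, t ∈ J.support → f.base t = IsLocalRing.closedPoint S) ∧
      IsBlowup π J ∧ Scheme.IsRegular T' :=
  (fermatSurfaceRung_of_ringKrullDim x hx hS n hd ℓ).2 T f hf

end ConeDepth

end Summit.ResolutionOfSingularities.ResolutionOfSingularities.Theorems

end
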